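import Summits.QuantumFields.BalabanUV.Beta.D1BFx.PackedCoframePairLimit

/-!
# BetaPertH road «BF-x» — «COFRAME-MASS» M1: two-centre letters WITH SEPARATION — the tools

STATUS: [folklore] `ℓ¹` bookkeeping for the road's (A1)-PACKED identity (BINDER row D1, slot (K)); NOT an estimate of Bałaban's, NOT a discharge of any
root-level binder.  Provenance: reconstruction; the manuscript(s) under audit are NOT citable.

WHY.  The END's (1.22) rows read the second-order N table only through a `z`-DECAY MASS LETTER `Σ'|ffW 𝒲 μ 0 ν z| ≤ mW·e^{−κ|z|₁}` (leaf-01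
`exists_END_rows_RkSand`, binder `hWm`).  The co-frame half of `ffW (W2NInf m a r S₂)` is `cofPairInf (m+1) a w w′` at weights centred at `P = 0` and
`P′ = (m+1)•z`; the (u1) letters of P3a∕P4a are per-base-point existentials through `biLoc_recentre` (constant `× e^{θ|P−P′|₁}`) — no `z`-decay can be
read off them.  CURRENCY HERE: `BiLoc X P P′ (K·e^{−ρ|P−P′|₁}) ρ` with `K` free of the centres and of the weights (only their envelope `(C, δ)`).
* §1 [folklore] tools: `exp_sep_le`, `abs_mul_weight_sep` (a product of weights at two centres is ONE weight carrying `e^{−(δ∕2)|P−P′|}`),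
  `biLoc_recentre_snd∕fst` (re-centring paid from separation), `mass_le_of_biLoc₂` (plain two-centre mass `≤ |F|²·C·Zl²`), masses of sums ∕
  multiples ∕ transposes, `biLoc_sep_mono`, and composition wrappers keeping the separation factor visible;
  M1j (`PackedCoframeSepJets`): `biLoc_dSw₂`, `biLoc_jetCw_of_biLoc` ∕ `biLoc_jetRw_of_biLoc` (tip weight at ANOTHER centre ⇒ separation), `biLoc_jetRCw_sep`.
M1b (`PackedCoframeSepKernels`) gives the site kernels of the words with ONE constant for all centres∕weights; M2 (`PackedCoframePairMass`) the words,
`cofPairInf` and the mass letter.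
Unit `b2b-balaban-beta-d1-formalise-leaf-03` (gen 24); road owner `b2b-balaban-beta-d1-p2`.
-/

noncomputable section

namespace Summit.QuantumFields.BalabanUV.Beta.D1BFx.PackedCoframeSep

open scoped BigOperators
open Literature.MathematicalPhysics.QuantumFieldTheory.Balaban1983to89
open Literature.MathematicalPhysics.QuantumFieldTheory.Balaban1983to89.Beta
open B12Sec2to5 (l1 l1_nonneg)
open ExpKernelCalculus (Site MKer BiLoc Decays comp Zl Zl_pos Zl_nonneg l1_sub_triangle l1_sub_symm summable_exp_shift' tsum_exp_shift'
  biLoc_comp_decays biLoc_comp_biLoc)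
open BalabanStepJetsSucc (biLoc_comp_right)
open KernelWard (biLoc_recentre biLoc_add)
open StepJetData (biLoc_weaken)
open Summit.QuantumFields.BalabanUV.Beta.TameKernelCalculus (decays_of_le biLoc_of_le trK biLoc_trK)
open Summit.QuantumFields.BalabanUV.Beta.D1BFx.GhostStencil (l1_zero)

/-! ## §1 Tools: separation in the constant -/

section Tools

variable {D : ℕ} {F : Type*}

/-- [folklore] **SEPARATION SPLIT**: `e^{−θ|z−P|}·e^{−θ|z−Q|} ≤ e^{−(θ∕2)|P−Q|}·e^{−(θ∕2)(|z−P|+|z−Q|)}` (`θ ≥ 0`; triangle inequality through `z`). -/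
theorem exp_sep_le {θ : ℝ} (hθ : 0 ≤ θ) (z P Q : Site D) :
    Real.exp (-θ * l1 (z - P)) * Real.exp (-θ * l1 (z - Q))
      ≤ Real.exp (-(θ / 2) * l1 (P - Q)) * Real.exp (-(θ / 2) * (l1 (z - P) + l1 (z - Q))) := by
  rw [← Real.exp_add, ← Real.exp_add]
  refine Real.exp_le_exp.mpr ?_
  have ht : l1 (P - Q) ≤ l1 (z - P) + l1 (z - Q) := by
    have h := l1_sub_triangle P z Q
    rwa [l1_sub_symm P z] at h
  nlinarith [l1_nonneg (z - P), l1_nonneg (z - Q)]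

/-- [folklore] **THE PRODUCT OF TWO WEIGHTS AT DIFFERENT CENTRES IS ONE WEIGHT WITH THE SEPARATION IN ITS CONSTANT**:
`|w κ u| ≤ C e^{−δ|u−P|}`, `|w′ κ u| ≤ C′ e^{−δ|u−P′|}` ⟹ `|w κ u · w′ κ u| ≤ (C·C′·e^{−(δ∕2)|P−P′|})·e^{−(δ∕2)|u−P|}`. -/
theorem abs_mul_weight_sep {w w' : Fin 4 → (Fin 4 → ℤ) → ℝ} {C C' δ : ℝ} {P P' : Fin 4 → ℤ}
    (hw : ∀ κ u, |w κ u| ≤ C * Real.exp (-δ * l1 (u - P))) (hw' : ∀ κ u, |w' κ u| ≤ C' * Real.exp (-δ * l1 (u - P'))) (hδ : 0 ≤ δ)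
    (κ : Fin 4) (u : Fin 4 → ℤ) :
    |w κ u * w' κ u| ≤ C * C' * Real.exp (-(δ / 2) * l1 (P - P')) * Real.exp (-(δ / 2) * l1 (u - P)) := by
  have hC : 0 ≤ C :=
    (abs_nonneg (w κ P)).trans ((hw κ P).trans_eq (by rw [sub_self, l1_zero, mul_zero, Real.exp_zero, mul_one]))
  have hC' : 0 ≤ C' :=
    (abs_nonneg (w' κ P')).trans ((hw' κ P').trans_eq (by rw [sub_self, l1_zero, mul_zero, Real.exp_zero, mul_one]))
  rw [abs_mul]
  calc |w κ u| * |w' κ u| ≤ (C * Real.exp (-δ * l1 (u - P))) * (C' * Real.exp (-δ * l1 (u - P'))) :=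
        mul_le_mul (hw κ u) (hw' κ u) (abs_nonneg _) (mul_nonneg hC (Real.exp_pos _).le)
    _ = C * C' * (Real.exp (-δ * l1 (u - P)) * Real.exp (-δ * l1 (u - P'))) := by ring
    _ ≤ C * C' * (Real.exp (-(δ / 2) * l1 (P - P')) * Real.exp (-(δ / 2) * (l1 (u - P) + l1 (u - P')))) :=
        mul_le_mul_of_nonneg_left (exp_sep_le hδ u P P') (mul_nonneg hC hC')
    _ ≤ C * C' * (Real.exp (-(δ / 2) * l1 (P - P')) * Real.exp (-(δ / 2) * l1 (u - P))) := by
        refine mul_le_mul_of_nonneg_left (mul_le_mul_of_nonneg_left (Real.exp_le_exp.mpr ?_) (Real.exp_pos _).le) (mul_nonneg hC hC')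
        nlinarith [l1_nonneg (u - P')]
    _ = C * C' * Real.exp (-(δ / 2) * l1 (P - P')) * Real.exp (-(δ / 2) * l1 (u - P)) := by ring

/-- [folklore] **RE-CENTRING THE SECOND SLOT, PAID FROM SEPARATION**: `BiLoc K p q (K₀·e^{−s|q−q′|}) ρ`, `0 ≤ ρ ≤ s` ⟹ `BiLoc K p q′ (K₀·e^{−(s−ρ)|q−q′|}) ρ`. -/
theorem biLoc_recentre_snd {K : MKer D F} {p q q' : Site D} {K₀ s ρ : ℝ}
    (h : BiLoc K p q (K₀ * Real.exp (-s * l1 (q - q'))) ρ) (hρ : 0 ≤ ρ) :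
    BiLoc K p q' (K₀ * Real.exp (-(s - ρ) * l1 (q - q'))) ρ := by
  have h1 := biLoc_recentre h hρ p q'
  rw [sub_self, LimitRate.l1_zero, zero_add] at h1
  refine biLoc_weaken h1 (le_of_eq ?_) le_rfl
  rw [mul_assoc, ← Real.exp_add]; ring_nf

/-- [folklore] The same for the first slot: `BiLoc K p q (K₀·e^{−s|p−p′|}) ρ` ⟹ `BiLoc K p′ q (K₀·e^{−(s−ρ)|p−p′|}) ρ`. -/
theorem biLoc_recentre_fst {K : MKer D F} {p p' q : Site D} {K₀ s ρ : ℝ}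
    (h : BiLoc K p q (K₀ * Real.exp (-s * l1 (p - p'))) ρ) (hρ : 0 ≤ ρ) :
    BiLoc K p' q (K₀ * Real.exp (-(s - ρ) * l1 (p - p'))) ρ := by
  have h1 := biLoc_recentre h hρ p' q
  rw [sub_self, LimitRate.l1_zero, add_zero] at h1
  refine biLoc_weaken h1 (le_of_eq ?_) le_rfl
  rw [mul_assoc, ← Real.exp_add]; ring_nf

variable [Fintype F]

/-- [folklore] **THE PLAIN TWO-CENTRE MASS**: `BiLoc K p q C δ`, `0 < δ` ⊢ `Σ'_{(x,y)} Σ_{a b} |K x y a b|` is summable and `≤ |F|²·C·Zl D δ²`. -/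
theorem mass_le_of_biLoc₂ {K : MKer D F} {p q : Site D} {C δ : ℝ} (hK : BiLoc K p q C δ) (hδ : 0 < δ) :
    (Summable fun pq : Site D × Site D => ∑ a, ∑ b, |K pq.1 pq.2 a b|) ∧
      ∑' pq : Site D × Site D, ∑ a, ∑ b, |K pq.1 pq.2 a b| ≤ (Fintype.card F : ℝ) ^ 2 * C * Zl D δ ^ 2 := by
  set g : Site D × Site D → ℝ := fun pq => (Fintype.card F : ℝ) ^ 2 * C
      * (Real.exp (-δ * l1 (pq.1 - p)) * Real.exp (-δ * l1 (pq.2 - q))) with hg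
  have hgs : Summable g :=
    ((summable_exp_shift' hδ p).mul_of_nonneg (summable_exp_shift' hδ q)
      (fun _ => (Real.exp_pos _).le) (fun _ => (Real.exp_pos _).le)).mul_left ((Fintype.card F : ℝ) ^ 2 * C)
  have hle : ∀ pq : Site D × Site D, ∑ a, ∑ b, |K pq.1 pq.2 a b| ≤ g pq := by
    intro pq
    calc ∑ a, ∑ b, |K pq.1 pq.2 a b|
        ≤ ∑ _a : F, ∑ _b : F, C * (Real.exp (-δ * l1 (pq.1 - p)) * Real.exp (-δ * l1 (pq.2 - q))) :=
          Finset.sum_le_sum fun a _ => Finset.sum_le_sum fun b _ => by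
            have h1 := hK pq.1 pq.2 a b
            rwa [mul_add, Real.exp_add] at h1
      _ = g pq := by
          simp only [Finset.sum_const, Finset.card_univ, hg]; ring
  have h0 : ∀ pq : Site D × Site D, 0 ≤ ∑ a, ∑ b, |K pq.1 pq.2 a b| :=
    fun pq => Finset.sum_nonneg fun a _ => Finset.sum_nonneg fun b _ => abs_nonneg _
  have hs : Summable fun pq : Site D × Site D => ∑ a, ∑ b, |K pq.1 pq.2 a b| := Summable.of_nonneg_of_le h0 hle hgs
  refine ⟨hs, ?_⟩
  calc ∑' pq : Site D × Site D, ∑ a, ∑ b, |K pq.1 pq.2 a b| ≤ ∑' pq, g pq := hs.tsum_le_tsum hle hgs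
    _ = (Fintype.card F : ℝ) ^ 2 * C * Zl D δ ^ 2 := by
        have hn : ∀ c : Site D, Summable fun x : Site D => ‖Real.exp (-δ * l1 (x - c))‖ := fun c => by
          simpa only [Real.norm_eq_abs, abs_of_nonneg (Real.exp_pos _).le] using summable_exp_shift' hδ c
        rw [hg, tsum_mul_left, ← tsum_mul_tsum_of_summable_norm (hn p) (hn q), tsum_exp_shift', tsum_exp_shift']
        ring


/-! ### Composition wrappers keeping the separation factor `E` visible -/

/-- [folklore] `Decays A C δ`, `BiLoc K p q (K₀·E) δ`, `0 ≤ δ′ < δ` ⊢ `BiLoc (A∘K) p q ((|F|·C·K₀·Zl(δ−δ′))·E) δ′`. -/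
theorem biLoc_comp_decays_sep {A K : MKer D F} {C K₀ E δ δ' : ℝ} (hA : Decays A C δ) {p q : Site D} (hK : BiLoc K p q (K₀ * E) δ)
    (h0 : 0 ≤ δ') (h1 : δ' < δ) :
    BiLoc (comp A K) p q (((Fintype.card F : ℝ) * (C * K₀) * Zl D (δ - δ')) * E) δ' :=
  biLoc_weaken (biLoc_comp_decays hA hK h0 h1) (le_of_eq (by ring)) le_rfl

/-- [folklore] `BiLoc K p q (K₀·E) δ`, `Decays A C δ`, `0 ≤ δ′ < δ` ⊢ `BiLoc (K∘A) p q ((|F|·K₀·C·Zl(δ−δ′))·E) δ′`. -/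
theorem biLoc_comp_right_sep {K A : MKer D F} {C K₀ E δ δ' : ℝ} {p q : Site D} (hK : BiLoc K p q (K₀ * E) δ) (hA : Decays A C δ)
    (h0 : 0 ≤ δ') (h1 : δ' < δ) :
    BiLoc (comp K A) p q (((Fintype.card F : ℝ) * (K₀ * C) * Zl D (δ - δ')) * E) δ' :=
  biLoc_weaken (biLoc_comp_right hK hA h0 h1) (le_of_eq (by ring)) le_rfl

/-- [folklore] **CHAIN SEPARATION** (`biLoc_comp_biLoc` in this file's currency): `BiLoc K p p′ C δ`, `BiLoc K′ q′ q C′ δ`, `0 < δ` ⊢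
`BiLoc (K∘K′) p q ((|F|·C·C′·Zl(δ∕2))·e^{−(δ∕2)|p′−q′|}) δ`. -/
theorem biLoc_comp_biLoc_sep {K K' : MKer D F} {C C' δ : ℝ} {p p' q' q : Site D} (hK : BiLoc K p p' C δ) (hK' : BiLoc K' q' q C' δ)
    (hδ : 0 < δ) :
    BiLoc (comp K K') p q (((Fintype.card F : ℝ) * (C * C') * Zl D (δ / 2)) * Real.exp (-(δ / 2) * l1 (p' - q'))) δ :=
  biLoc_comp_biLoc hK hK' hδ


/-! ### Monotonicity in the separation rate; masses of sums, multiples, transposes -/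

omit [Fintype F] in
/-- [folklore] Lowering the separation rate in the constant (`K ≥ 0` is read off the bound itself). -/
theorem biLoc_sep_mono [Nonempty F] {X : MKer D F} {p q : Site D} {K s s' t ρ : ℝ} (h : BiLoc X p q (K * Real.exp (-s * t)) ρ)
    (hs : s' ≤ s) (ht : 0 ≤ t) : BiLoc X p q (K * Real.exp (-s' * t)) ρ := by
  have h0 := h.nonneg (Classical.arbitrary F)
  have hK : 0 ≤ K := le_of_mul_le_mul_right (by rwa [zero_mul]) (Real.exp_pos (-s * t))
  exact biLoc_weaken h (mul_le_mul_of_nonneg_left (Real.exp_le_exp.mpr (by nlinarith)) hK) le_rfl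

/-- [folklore] **MASS OF A SUM** (triangle inequality, termwise). -/
theorem mass_add_le {X Y : MKer D F} (hX : Summable fun pq : Site D × Site D => ∑ a, ∑ b, |X pq.1 pq.2 a b|)
    (hY : Summable fun pq : Site D × Site D => ∑ a, ∑ b, |Y pq.1 pq.2 a b|) :
    (Summable fun pq : Site D × Site D => ∑ a, ∑ b, |(X + Y) pq.1 pq.2 a b|) ∧
      ∑' pq : Site D × Site D, ∑ a, ∑ b, |(X + Y) pq.1 pq.2 a b|
        ≤ (∑' pq : Site D × Site D, ∑ a, ∑ b, |X pq.1 pq.2 a b|) + ∑' pq : Site D × Site D, ∑ a, ∑ b, |Y pq.1 pq.2 a b| := by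
  have hle : ∀ pq : Site D × Site D, ∑ a, ∑ b, |(X + Y) pq.1 pq.2 a b| ≤ (∑ a, ∑ b, |X pq.1 pq.2 a b|) + ∑ a, ∑ b, |Y pq.1 pq.2 a b| := by
    intro pq
    rw [← Finset.sum_add_distrib]
    refine Finset.sum_le_sum fun a _ => ?_
    rw [← Finset.sum_add_distrib]
    exact Finset.sum_le_sum fun b _ => abs_add_le _ _
  have h0 : ∀ pq : Site D × Site D, 0 ≤ ∑ a, ∑ b, |(X + Y) pq.1 pq.2 a b| :=
    fun pq => Finset.sum_nonneg fun a _ => Finset.sum_nonneg fun b _ => abs_nonneg _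
  have hs := Summable.of_nonneg_of_le h0 hle (hX.add hY)
  exact ⟨hs, (hs.tsum_le_tsum hle (hX.add hY)).trans_eq (hX.tsum_add hY)⟩

/-- [folklore] Mass of the negative. -/
theorem mass_neg_eq (X : MKer D F) :
    (fun pq : Site D × Site D => ∑ a, ∑ b, |(-X) pq.1 pq.2 a b|) = fun pq => ∑ a, ∑ b, |X pq.1 pq.2 a b| := by
  funext pq; simp only [Pi.neg_apply, abs_neg]

/-- [folklore] **MASS OF A DIFFERENCE.** -/
theorem mass_sub_le {X Y : MKer D F} (hX : Summable fun pq : Site D × Site D => ∑ a, ∑ b, |X pq.1 pq.2 a b|)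
    (hY : Summable fun pq : Site D × Site D => ∑ a, ∑ b, |Y pq.1 pq.2 a b|) :
    (Summable fun pq : Site D × Site D => ∑ a, ∑ b, |(X - Y) pq.1 pq.2 a b|) ∧
      ∑' pq : Site D × Site D, ∑ a, ∑ b, |(X - Y) pq.1 pq.2 a b|
        ≤ (∑' pq : Site D × Site D, ∑ a, ∑ b, |X pq.1 pq.2 a b|) + ∑' pq : Site D × Site D, ∑ a, ∑ b, |Y pq.1 pq.2 a b| := by
  have hY' : Summable fun pq : Site D × Site D => ∑ a, ∑ b, |(-Y) pq.1 pq.2 a b| := by rwa [mass_neg_eq]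
  have h := mass_add_le hX hY'
  rw [mass_neg_eq, ← sub_eq_add_neg] at h
  exact h

/-- [folklore] Mass of a scalar multiple. -/
theorem mass_smul_eq (c : ℝ) (X : MKer D F) :
    (fun pq : Site D × Site D => ∑ a, ∑ b, |(c • X) pq.1 pq.2 a b|) = fun pq => |c| * ∑ a, ∑ b, |X pq.1 pq.2 a b| := by
  funext pq; simp only [Pi.smul_apply, smul_eq_mul, abs_mul, Finset.mul_sum]

/-- [folklore] **MASS OF A SCALAR MULTIPLE.** -/
theorem mass_smul_le (c : ℝ) {X : MKer D F} (hX : Summable fun pq : Site D × Site D => ∑ a, ∑ b, |X pq.1 pq.2 a b|) :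
    (Summable fun pq : Site D × Site D => ∑ a, ∑ b, |(c • X) pq.1 pq.2 a b|) ∧
      ∑' pq : Site D × Site D, ∑ a, ∑ b, |(c • X) pq.1 pq.2 a b| = |c| * ∑' pq : Site D × Site D, ∑ a, ∑ b, |X pq.1 pq.2 a b| := by
  rw [mass_smul_eq]
  exact ⟨hX.mul_left _, tsum_mul_left⟩

/-- [folklore] **MASS OF THE TRANSPOSE** (`trK`): the same sum re-indexed by `(x,y) ↦ (y,x)`, `(a,b) ↦ (b,a)`. -/
theorem mass_trK {X : MKer D F} (hX : Summable fun pq : Site D × Site D => ∑ a, ∑ b, |X pq.1 pq.2 a b|) :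
    (Summable fun pq : Site D × Site D => ∑ a, ∑ b, |trK X pq.1 pq.2 a b|) ∧
      ∑' pq : Site D × Site D, ∑ a, ∑ b, |trK X pq.1 pq.2 a b| = ∑' pq : Site D × Site D, ∑ a, ∑ b, |X pq.1 pq.2 a b| := by
  have e : ∀ pq : Site D × Site D, (∑ a, ∑ b, |trK X pq.1 pq.2 a b|)
      = (fun pq' : Site D × Site D => ∑ a, ∑ b, |X pq'.1 pq'.2 a b|) ((Equiv.prodComm (Site D) (Site D)) pq) := by
    intro pq
    simp only [Equiv.prodComm_apply, Prod.fst_swap, Prod.snd_swap, TameKernelCalculus.trK_apply]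
    exact Finset.sum_comm
  have hs : Summable fun pq : Site D × Site D => ∑ a, ∑ b, |trK X pq.1 pq.2 a b| := by
    rw [show (fun pq : Site D × Site D => ∑ a, ∑ b, |trK X pq.1 pq.2 a b|)
        = (fun pq' : Site D × Site D => ∑ a, ∑ b, |X pq'.1 pq'.2 a b|) ∘ (Equiv.prodComm (Site D) (Site D)) from funext e]
    exact (Equiv.summable_iff _).mpr hX
  refine ⟨hs, ?_⟩
  rw [tsum_congr e]
  exact Equiv.tsum_eq (Equiv.prodComm (Site D) (Site D)) (fun pq' : Site D × Site D => ∑ a, ∑ b, |X pq'.1 pq'.2 a b|)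

end Tools



end Summit.QuantumFields.BalabanUV.Beta.D1BFx.PackedCoframeSep

end
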